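import Mathlib.AlgebraicGeometry.AffineScheme
import Mathlib.RingTheory.Spectrum.Prime.Topology
import HarnessLib

/-!
# Germs of pulled-back functions at a point survive if they are invertible at a generisation
# («a horizontal point of a scheme over a local base sees the base's maximal ideal faithfully»)

Topic: `Literature/AlgebraicGeometry/Morphisms`. Elementary bookkeeping on stalks, specialisations and basic opens:

* `Scheme.germ_appTop_ne_zero_of_specializes` — for a morphism `f : X ⟶ Y`, a global function `r` on `Y`, and points `c ⤳ x'`
  of `X` with `f c` in the non-vanishing locus `Y_r`: the germ of `f^* r` at `x'` is NON-ZERO (it maps to a unit of `𝒪_{X,c}`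
  under the specialisation map `𝒪_{X,x'} → 𝒪_{X,c}`);
* `Scheme.isUnit_germ_appTop_of_mem_basicOpen` — at `c` itself that germ is a unit;
* over a LOCAL base `Spec O`: a point `c` of `X` NOT over the closed point lies in `X_{f^* r}` for some `r` in the maximal
  ideal of `O` (`Scheme.exists_mem_maximalIdeal_mem_basicOpen_of_ne_closedPoint`), hence
  **`Scheme.exists_germ_ne_zero_of_specializes_of_ne_closedPoint`**: if `c ⤳ x'` and `c` is not in the special fibre, then
  some element of `𝔪_O` has a non-zero germ at `x'` which becomes a unit at `c`. For an `O`-scheme whose local ring at `x'` is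
  a DOMAIN (e.g. regular) this says that `𝒪_{X,x'}` is torsion-free, i.e. FLAT, over a discrete valuation ring `O` as soon as
  `x'` has a generisation in the generic fibre — the first sentence of every «first touch» analysis of a blow-up centre that
  meets the special fibre along a subvariety and is not contained in it (cell `res-hironaka`, W4.5(b), K5-BMY STEP 0).

Everything is PROVED; no definitions, no named facts. [folklore] bookkeeping over Mathlib's `Scheme.mem_basicOpen`,
`Scheme.preimage_basicOpen`, `TopCat.Presheaf.germ_stalkSpecializes`, `basicOpen_eq_of_affine`.

## Sources
* The Stacks Project, Tag 01J7 (generisations of a point and the local ring), Tag 00E0 (basic opens of `Spec`). [StacksProject]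
-/

noncomputable section

open CategoryTheory TopologicalSpace IsLocalRing

namespace Literature.AlgebraicGeometry.Morphisms

open _root_.AlgebraicGeometry

universe u

/-- **The germ at `c` of `f^* r` is a unit when `f c ∈ Y_r`.** [cite: StacksProject, Tag 01J7] -/
theorem Scheme.isUnit_germ_appTop_of_mem_basicOpen {X Y : Scheme.{u}} (f : X ⟶ Y) (r : Γ(Y, ⊤)) {c : X}
    (hc : f.base c ∈ Y.basicOpen r) : IsUnit (X.presheaf.germ ⊤ c trivial (f.appTop r)) := by
  rw [← Scheme.mem_basicOpen_top]
  have h1 : c ∈ f ⁻¹ᵁ Y.basicOpen r := hc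
  rwa [Scheme.preimage_basicOpen] at h1

/-- **A germ that is invertible at a generisation is non-zero**: for `f : X ⟶ Y`, `r ∈ Γ(Y, 𝒪_Y)` and `c ⤳ x'` in `X` with
`f c ∈ Y_r`, the germ of `f^* r` at `x'` is non-zero — its image under `𝒪_{X,x'} → 𝒪_{X,c}` is a unit of the (non-trivial)
local ring `𝒪_{X,c}`. [cite: StacksProject, Tag 01J7] -/
theorem Scheme.germ_appTop_ne_zero_of_specializes {X Y : Scheme.{u}} (f : X ⟶ Y) (r : Γ(Y, ⊤)) {c x' : X}
    (h : c ⤳ x') (hc : f.base c ∈ Y.basicOpen r) : X.presheaf.germ ⊤ x' trivial (f.appTop r) ≠ 0 := by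
  intro h0
  have hu := Scheme.isUnit_germ_appTop_of_mem_basicOpen f r hc
  have h1 := TopCat.Presheaf.germ_stalkSpecializes_apply X.presheaf (U := ⊤) (trivial : x' ∈ (⊤ : X.Opens)) h
    (f.appTop r)
  rw [← h1, h0, map_zero] at hu
  exact not_isUnit_zero hu

/-- **Points off the special fibre lie in some `X_{f^* r}`, `r ∈ 𝔪_O`.** For a local ring `O`, `f : X ⟶ Spec O` and a point
`c` with `f c ≠` the closed point: some `r` in the maximal ideal of `O` does not vanish at `f c`, i.e. `c ∈ X_{f^* r}` for the
global function `r` of `Spec O`. [cite: StacksProject, Tag 00E0] -/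
theorem Scheme.exists_mem_maximalIdeal_mem_basicOpen_of_ne_closedPoint {O : Type u} [CommRing O] [IsLocalRing O]
    {X : Scheme.{u}} (f : X ⟶ Spec (.of O)) {c : X} (hc : f.base c ≠ closedPoint O) :
    ∃ r ∈ maximalIdeal O, f.base c ∈ (Spec (.of O)).basicOpen ((Scheme.ΓSpecIso (.of O)).inv r) := by
  -- `f c ≠ 𝔪` means `𝔪 ⊄ (f c)`: pick `r ∈ 𝔪 \ (f c)`
  have hne : ¬ maximalIdeal O ≤ (f.base c).asIdeal := fun hle =>
    hc (PrimeSpectrum.ext ((maximalIdeal.isMaximal O).eq_of_le (f.base c).isPrime.ne_top hle).symm)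
  obtain ⟨r, hr𝔪, hr⟩ := SetLike.not_le_iff_exists.mp hne
  refine ⟨r, hr𝔪, ?_⟩
  rw [basicOpen_eq_of_affine]
  exact hr

/-- **A point with a generisation off the special fibre sees the maximal ideal of the base.** For a local ring `O`,
`f : X ⟶ Spec O`, and points `c ⤳ x'` of `X` with `f c ≠` the closed point (`c` is not in the special fibre): some
`r ∈ 𝔪_O` has NON-ZERO germ `f^* r` at `x'` and invertible germ at `c`. If `𝒪_{X,x'}` is a domain (e.g. `x'` a regular
point) the germ is then a non-zero-divisor — for a discrete valuation ring `O` this is flatness of `𝒪_{X,x'}` over `O`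
(torsion-free), the «regular + horizontal ⇒ `O`-flat at the touching point» step of a first-touch analysis.
[cite: StacksProject, Tag 01J7; StacksProject, Tag 00E0] -/
theorem Scheme.exists_germ_ne_zero_of_specializes_of_ne_closedPoint {O : Type u} [CommRing O] [IsLocalRing O]
    {X : Scheme.{u}} (f : X ⟶ Spec (.of O)) {c x' : X} (h : c ⤳ x') (hc : f.base c ≠ closedPoint O) :
    ∃ r ∈ maximalIdeal O,
      X.presheaf.germ ⊤ x' trivial (f.appTop ((Scheme.ΓSpecIso (.of O)).inv r)) ≠ 0 ∧
        IsUnit (X.presheaf.germ ⊤ c trivial (f.appTop ((Scheme.ΓSpecIso (.of O)).inv r))) := by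
  obtain ⟨r, hr𝔪, hr⟩ := Scheme.exists_mem_maximalIdeal_mem_basicOpen_of_ne_closedPoint f hc
  exact ⟨r, hr𝔪, Scheme.germ_appTop_ne_zero_of_specializes f _ h hr,
    Scheme.isUnit_germ_appTop_of_mem_basicOpen f _ hr⟩

/-- The same conclusion for a DOMAIN stalk, in the form «a non-zero-divisor of `𝒪_{X,x'}` coming from `𝔪_O`».
[cite: StacksProject, Tag 01J7] -/
theorem Scheme.exists_mem_maximalIdeal_germ_mem_nonZeroDivisors {O : Type u} [CommRing O] [IsLocalRing O]
    {X : Scheme.{u}} (f : X ⟶ Spec (.of O)) {c x' : X} (h : c ⤳ x') (hc : f.base c ≠ closedPoint O)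
    [IsDomain (X.presheaf.stalk x')] :
    ∃ r ∈ maximalIdeal O,
      X.presheaf.germ ⊤ x' trivial (f.appTop ((Scheme.ΓSpecIso (.of O)).inv r)) ∈
        nonZeroDivisors (X.presheaf.stalk x') := by
  obtain ⟨r, hr𝔪, hne, -⟩ := Scheme.exists_germ_ne_zero_of_specializes_of_ne_closedPoint f h hc
  exact ⟨r, hr𝔪, mem_nonZeroDivisors_of_ne_zero hne⟩

end Literature.AlgebraicGeometry.Morphisms

end
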